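import Literature.Analysis.FunctionSpaces.TorusGevreyCompactness
import HarnessLib

/-!
# An `L²` limit of Gevrey-bounded honest fields on `T^d` has a Gevrey-bounded honest representative

Analysis/FunctionSpaces support file (everything proved; no definitions, no named facts), a corollary of the
compactness of Gevrey balls `Torus.exists_smooth_limit_of_gevrey_bound` (`TorusGevreyCompactness.lean`;
Foias–Temam 1989 Gevrey classes).  If smooth, divergence-free, mean-zero fields `vₙ : T^d → ℝ^d` with the
uniform Gevrey bound `∑_{k∈S} e^{2σ|k|} ‖v̂ₙ(k)‖² ≤ C` converge in `L²` to a square-integrable `f`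
(`∫‖vₙ − f‖² → 0`), then `f` is almost everywhere equal to a smooth, divergence-free, mean-zero field `w`
obeying the same Gevrey bound (`Torus.exists_smooth_rep_of_tendsto_of_gevrey_bound`): a subsequence converges
in `L²` to such a `w` by compactness, and `L²` limits are unique.  This is how Gevrey-class bounds that are
uniform along difference quotients pass to derivatives (in the datum) of Navier–Stokes trajectories, which are a
priori only `L²` classes.

## Mathlib / tree search

Tree (reused): `Torus.exists_smooth_limit_of_gevrey_bound`.  Mathlib: `MeasureTheory.integral_eq_zero_iff_of_nonneg`,
`MeasureTheory.MemLp.integrable_norm_pow`, `ge_of_tendsto'`, `StrictMono.tendsto_atTop`.  Searched `Gevrey.*limit`,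
`smooth_rep`, `ae_eq.*IsSmooth.*Gevrey`: only the compactness theorem above (subsequence form, no identification of a
prescribed `L²` limit).

## References

* C. Foias, R. Temam, *Gevrey class regularity for the solutions of the Navier–Stokes equations*,
  J. Funct. Anal. 87 (1989), 359–369 (the Gevrey classes `D(e^{σA^{1/2}})`). [FoiasTemam1989]
-/

noncomputable section

open _root_.MeasureTheory Set Filter Function UnitAddTorus
open scoped Topology ENNReal BigOperators

namespace Literature.Analysis.FunctionSpaces

namespace Torus

variable {d : Type*} [Fintype d] [DecidableEq d]

omit [DecidableEq d] in
/-- `∫‖f − g‖² ≤ 2∫‖h − f‖² + 2∫‖h − g‖²` for square-integrable fields (pointwise parallelogram bound). [folklore] -/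
theorem integral_norm_sub_sq_le_two_mul_add {f g h : UnitAddTorus d → EuclideanSpace ℝ d} (hf : MemLp f 2 volume)
    (hg : MemLp g 2 volume) (hh : MemLp h 2 volume) :
    ∫ x, ‖f x - g x‖ ^ 2 ≤ 2 * (∫ x, ‖h x - f x‖ ^ 2) + 2 * ∫ x, ‖h x - g x‖ ^ 2 := by
  have hpt : ∀ x, ‖f x - g x‖ ^ 2 ≤ 2 * ‖h x - f x‖ ^ 2 + 2 * ‖h x - g x‖ ^ 2 := fun x => by
    have h1 : ‖f x - g x‖ ≤ ‖h x - f x‖ + ‖h x - g x‖ := by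
      calc ‖f x - g x‖ = ‖(h x - g x) - (h x - f x)‖ := by rw [sub_sub_sub_cancel_left]
        _ ≤ ‖h x - g x‖ + ‖h x - f x‖ := norm_sub_le _ _
        _ = ‖h x - f x‖ + ‖h x - g x‖ := add_comm _ _
    nlinarith [norm_nonneg (f x - g x), norm_nonneg (h x - f x), norm_nonneg (h x - g x),
      sq_nonneg (‖h x - f x‖ - ‖h x - g x‖)]
  have i1 : Integrable (fun x => ‖h x - f x‖ ^ 2) volume := (hh.sub hf).integrable_norm_pow two_ne_zero
  have i2 : Integrable (fun x => ‖h x - g x‖ ^ 2) volume := (hh.sub hg).integrable_norm_pow two_ne_zero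
  calc ∫ x, ‖f x - g x‖ ^ 2 ≤ ∫ x, (2 * ‖h x - f x‖ ^ 2 + 2 * ‖h x - g x‖ ^ 2) :=
        integral_mono_of_nonneg (ae_of_all _ fun x => sq_nonneg _) ((i1.const_mul 2).add (i2.const_mul 2))
          (ae_of_all _ hpt)
    _ = 2 * (∫ x, ‖h x - f x‖ ^ 2) + 2 * ∫ x, ‖h x - g x‖ ^ 2 := by
        rw [integral_add (i1.const_mul 2) (i2.const_mul 2), integral_const_mul, integral_const_mul]

/-- **An `L²` limit of Gevrey-bounded honest fields has a Gevrey-bounded honest representative.**  Let `σ > 0` and let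
`vₙ : T^d → ℝ^d` be smooth, divergence free and mean zero with `∑_{k∈S} e^{2σ|k|} ‖𝓕(complexify ∘ vₙ)(k)‖² ≤ C` for
all `n` and all finite `S`, and let `∫‖vₙ − f‖² → 0` for a square-integrable `f`.  Then there is a smooth,
divergence-free, mean-zero `w` with the same Gevrey bound and `f = w` almost everywhere (compactness of the Gevrey
ball, `Torus.exists_smooth_limit_of_gevrey_bound`, and uniqueness of `L²` limits). [folklore] -/
theorem exists_smooth_rep_of_tendsto_of_gevrey_bound {σ C : ℝ} (hσ : 0 < σ)
    (v : ℕ → UnitAddTorus d → EuclideanSpace ℝ d)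
    (hv : ∀ n, IsSmooth (v n)) (hdiv : ∀ n, IsDivFree (v n)) (hmean : ∀ n, HasZeroMean (v n))
    (hG : ∀ n, ∀ S : Finset (d → ℤ), ∑ k ∈ S, Real.exp (2 * σ * Real.sqrt (freqNormSq k)) *
      ‖mFourierCoeff (EuclideanSpace.complexify ∘ v n) k‖ ^ 2 ≤ C)
    {f : UnitAddTorus d → EuclideanSpace ℝ d} (hf : MemLp f 2 volume)
    (hlim : Tendsto (fun n => ∫ x, ‖v n x - f x‖ ^ 2) atTop (𝓝 0)) :
    ∃ w : UnitAddTorus d → EuclideanSpace ℝ d, IsSmooth w ∧ IsDivFree w ∧ HasZeroMean w ∧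
      (∀ S : Finset (d → ℤ), ∑ k ∈ S, Real.exp (2 * σ * Real.sqrt (freqNormSq k)) *
        ‖mFourierCoeff (EuclideanSpace.complexify ∘ w) k‖ ^ 2 ≤ C) ∧ f =ᵐ[volume] w := by
  obtain ⟨w, ψ, hψ, hw, hwd, hwm, hwG, hL2, -⟩ := exists_smooth_limit_of_gevrey_bound hσ v hv hdiv hmean hG
  refine ⟨w, hw, hwd, hwm, hwG, ?_⟩
  -- `∫‖f − w‖² ≤ 2∫‖v_{ψ n} − f‖² + 2∫‖v_{ψ n} − w‖² → 0`
  have hwL : MemLp w 2 volume := hw.memLp 2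
  have hbound : ∀ n, ∫ x, ‖f x - w x‖ ^ 2 ≤ 2 * (∫ x, ‖v (ψ n) x - f x‖ ^ 2) + 2 * ∫ x, ‖v (ψ n) x - w x‖ ^ 2 :=
    fun n => integral_norm_sub_sq_le_two_mul_add hf hwL ((hv (ψ n)).memLp 2)
  have hlim' : Tendsto (fun n => 2 * (∫ x, ‖v (ψ n) x - f x‖ ^ 2) + 2 * ∫ x, ‖v (ψ n) x - w x‖ ^ 2) atTop (𝓝 0) := by
    have h1 := (hlim.comp hψ.tendsto_atTop).const_mul 2
    have h2 := hL2.const_mul 2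
    simpa using h1.add h2
  have hle : ∫ x, ‖f x - w x‖ ^ 2 ≤ 0 := ge_of_tendsto' hlim' hbound
  have hge : 0 ≤ ∫ x, ‖f x - w x‖ ^ 2 := integral_nonneg fun x => sq_nonneg _
  have hzero : ∫ x, ‖f x - w x‖ ^ 2 = 0 := le_antisymm hle hge
  have hint : Integrable (fun x => ‖f x - w x‖ ^ 2) volume := (hf.sub hwL).integrable_norm_pow two_ne_zero
  have hae := (integral_eq_zero_iff_of_nonneg (fun x => sq_nonneg _) hint).1 hzero
  filter_upwards [hae] with x hx
  have hx' : ‖f x - w x‖ ^ 2 = 0 := hx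
  rwa [sq_eq_zero_iff, norm_eq_zero, sub_eq_zero] at hx'

end Torus

end Literature.Analysis.FunctionSpaces

end
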